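import Summits.BirchSwinnertonDyer.Rank1Residual.GaloisImage.CongruenceVisibilityTwistedData
import Summits.BirchSwinnertonDyer.Rank1Residual.AdditivePotMult.TateUniformisationOfValuationJ
import Summits.BirchSwinnertonDyer.Rank1Residual.GaloisImage.NonsplitMultiplicativeKummerPlaces
import Literature.NumberTheory.DiophantineGeometry.LocalReductionHasMultiplicativeReductionAtProofs
import Summits.BirchSwinnertonDyer.Rank1Residual.GaloisImage.FormalGroupLocalDivisibilityRat
import Summits.BirchSwinnertonDyer.Rank1Residual.GaloisImage.PadicTwistClassDecider
import HarnessLib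

/-!
# Kind (iii′): the twisted Tate comparison at a place with `|j|_v > 1` on both sides — additive
# potentially-multiplicative places are FREE (cell `b2b-bsdres`, team n1011, row T-VIS3-TATE;
# seat p09 GEN 11; FILE M2 — the twisted Tate input is p12's row T-A41J)

HONEST FRAMING (cell `b2b-bsdres`, run/shared/lean/b2b/bsd-rank1-residual/, verbatim in every
file): the goal of the cell is to DELETE the COMBINATION-SHAPED residual classes of the
Birch–Swinnerton-Dyer formula for ALL analytic-rank `≤ 1` elliptic curves over `ℚ` — "full BSD
formula for every rank `≤ 1` curve in class `C`" assembled STRICTLY from published theorems — so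
that the rank-`≤ 1` remainder becomes exactly the CONSTRUCTION-SHAPED classes, which are TYPED
(missing-input `Prop`s), NOT attempted. This is not "finishing BSD". Team n1011 (N10 / N11, the
additive block X4 ∧ `p = 3`): research route on the CONSTRUCTION-SHAPED class X4; no claim beyond
the stated classes; nothing is booked; no mark / label / count is changed by this file. Theorems
only (no definition, no new named fact, no `sorry`); general (any number field, any odd prime `p`)
and cell-independent. CONDITIONAL (where said) on the registered named facts
`Silverman1994_thmV53_tateUniformisation` (A40, `hU`) and
`Silverman1994_thmV53_corV54_tateUniformisation` (A41, `hU2`: Silverman, *ATAEC* V, Lemma 5.2 (c),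
Thm. 5.3, Cor. 5.4 at a multiplicative place) — EXACTLY the binders of the existing kind-(iii)
certificates; the general form under the PRINTED hypothesis `|j(E)|_v > 1` is the THEOREM
`AdditivePotMult.TateOfValuationJ.tateUniformisation_of_one_lt_valuation_j` (seat p12, row T-A41J:
derived from A41 by quadratic-twist descent; no new named fact). Closes NO class by itself: it frees one more kind of place in a
per-row visibility certificate whose other inputs are EVIDENCE until kernel-certified.

## What

* `one_lt_valuation_j_of_hasMultiplicativeReductionAt`: multiplicative reduction at `v` forces
  `|j(E)|_v > 1` (Silverman *AEC* VII.5.1 (b): the minimal model has `|c₄|_v = 1`, `|Δ|_v < 1`, and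
  `j = c₄³/Δ` is an invariant) — kind (iii) is the special case of kind (iii′).
* KIND (iii′) `h1Equiv_mem_selmerLocalKer_of_one_lt_valuation_j`: `p` odd, `θ : E′[p] ⥲ E[p]` a
  `Γ_K`-isomorphism, `v` any finite place with `|j(E)|_v > 1` and `|j(E′)|_v > 1` (multiplicative OR
  additive potentially-multiplicative reduction on either side), `γ(E) = r² γ(E′)` in `K_v`
  (`γ = -c₄/c₆`), `μ_p(K_v) = 1` ⟹ `θ_* 𝓢_v(E′) ≤ 𝓢_v(E)` (FILE M1's data form fed by p12's
  T-A41J theorem under `hU2 : A41`); `relIndex_map_selmerLocalKer_eq_one_of_one_lt_valuation_j`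
  (`ι_v(θ) = 1`).
* END `exists_sha_ne_zero_of_congr_of_places₆`: the refined certificate
  `NonsplitKummer.exists_sha_ne_zero_of_congr_of_places₅` (kinds (i) `v ∤ p`, `E′(K_v)[p] = 0`;
  (ii) both split multiplicative, `#E(K_v)[p] ≤ p`; (iii) both multiplicative, same `γ`-class,
  `μ_p(K_v) = 1`; (iv′)/(vi) one side non-split multiplicative, the other good, `v ∤ p`) with the
  SIXTH free kind (iii′); SAME binders `hU : A40`, `hU2 : A41` as `…_of_places₅`.
* ℚ reading `one_lt_valuation_iff_padicValRat_neg` / `one_lt_valuation_iff_dvd_den`: for a place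
  `v` of `ℚ` over `ℓ` and `x ≠ 0`, `1 < v(x) ↔ ord_ℓ x < 0 ↔ ℓ ∣ den x` (records: `x = j(E)`);
  `kindIIIPrime_numerals_three_of_certs`: the whole sixth disjunct at a place of `ℚ` from
  displayed / `decide`-able per-row data (the two `j`-invariants + p17's twist-class and `μ₃`
  certificates of `PadicTwistClassDecider.lean`).

Value (r1 ROUTE-1 §42.2, census = EVIDENCE, not a claim of this file): at `p = 3` over `ℚ` the
place `3` of an N11 target of additive potentially-multiplicative reduction facing a congruent
partner of the same kind becomes free (`+1 203` rows on roads PASS-T / PASS-T⁺).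

References: [SilvermanATAEC1994] Ch. V 5.2–5.4; [SilvermanAEC2009] VII.5.1 (b);
[CremonaMazur2000] §3; [AgasheStein2002] Thm. 3.1; [MilneADT2006] I 3.8.
-/

noncomputable section

open scoped Classical
open Field NumberField IsDedekindDomain WeierstrassCurve
open Literature.NumberTheory.EllipticCurves Literature.NumberTheory.GaloisRepresentations


namespace Summit.BirchSwinnertonDyer.Rank1Residual.GaloisImage

namespace TwistedKummer

/-! ### §1. Multiplicative reduction forces `|j|_v > 1` (kind (iii) ⊆ kind (iii′)) -/

section JInvariant

variable {A : Type*} [CommRing A] [IsDedekindDomain A] {K : Type*} [Field K]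
  [Algebra A K] [IsFractionRing A K] (v : HeightOneSpectrum A)

/-- For `k ∈ K`, "`𝔪_v`-adic valuation of `k` in `K_v` is `> 1`" may be read off in `K`: it
means `1 < v (k)` (companion of the tree's `valuation_maximalIdeal_adicCompletion_lt_one_iff`).
[folklore] -/
theorem one_lt_valuation_maximalIdeal_adicCompletion_iff (k : K) :
    1 < (IsDiscreteValuationRing.maximalIdeal (v.adicCompletionIntegers K)).valuation
        (v.adicCompletion K) (algebraMap K (v.adicCompletion K) k) ↔ 1 < v.valuation K k := by
  rw [(isEquiv_valuation_maximalIdeal_valued v).one_lt_iff_one_lt,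
    WeierstrassCurve.valued_algebraMap_adicCompletion]

variable {v} {W : WeierstrassCurve K}

/-- **Multiplicative reduction at `v` forces `|j(E)|_v > 1`** (Silverman *AEC* VII.5.1 (b):
"`E` has multiplicative reduction if and only if `v(Δ) > 0` and `v(c₄) = 0`", whence
`v(j) = 3 v(c₄) − v(Δ) < 0`): the chosen local minimal model `M = E • E_{K_v}` has `|c₄(M)|_v = 1`
and `|Δ(M)|_v < 1` (Mathlib's `HasMultiplicativeReduction`), `j(M) = Δ(M)⁻¹ c₄(M)³` has
`|j(M)|_v = |Δ(M)|_v⁻¹ > 1`, and `j(M) = j(E)` (`variableChange_j`, `map_j`).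
[cite: SilvermanAEC2009, VII.5 Prop. 5.1(b) (PDF p. 191)] -/
theorem one_lt_valuation_j_of_hasMultiplicativeReductionAt [W.IsElliptic]
    (h : W.HasMultiplicativeReductionAt v) : 1 < v.valuation K W.j := by
  haveI : (W.localMinimalModel v).IsElliptic := isElliptic_localMinimalModel v W
  set μ := (IsDiscreteValuationRing.maximalIdeal (v.adicCompletionIntegers K)).valuation
    (v.adicCompletion K) with hμ
  have hΔ : μ (W.localMinimalModel v).Δ < 1 := h.badReduction
  have hc₄ : μ (W.localMinimalModel v).c₄ = 1 := h.multiplicativeReduction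
  have hΔ0 : (W.localMinimalModel v).Δ ≠ 0 := by
    rw [← coe_Δ']
    exact (W.localMinimalModel v).Δ'.ne_zero
  have hjM : (W.localMinimalModel v).j = algebraMap K (v.adicCompletion K) W.j := by
    have key : ∀ C : VariableChange (v.adicCompletion K),
        (C • W.baseChange (v.adicCompletion K)).j = algebraMap K (v.adicCompletion K) W.j :=
      fun C ↦ by rw [variableChange_j]; exact W.map_j (algebraMap K (v.adicCompletion K))
    exact key _
  have hval : 1 < μ (W.localMinimalModel v).j := by
    have hj : (W.localMinimalModel v).j =
        ((W.localMinimalModel v).Δ)⁻¹ * (W.localMinimalModel v).c₄ ^ 3 := by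
      rw [WeierstrassCurve.j, Units.val_inv_eq_inv_val, coe_Δ']
    rw [hj, map_mul, map_pow, hc₄, one_pow, mul_one]
    exact (Valuation.val_lt_one_iff μ hΔ0).mp hΔ
  rw [hjM] at hval
  exact (one_lt_valuation_maximalIdeal_adicCompletion_iff v W.j).mp hval

end JInvariant

/-! ### §2. Kind (iii′) -/

section KindIIIPrime

variable {K : Type} [Field K] [NumberField K] (W : WeierstrassCurve K) [W.IsElliptic]
  {p : ℕ} [hp : Fact p.Prime] (v : HeightOneSpectrum (𝓞 K))

/-- **KIND (iii′): the local Kummer conditions of two `p`-congruent curves agree at a place where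
both have `|j|_v > 1` and the same twist class, when `μ_p(K_v) = 1`.** Let `E = W`, `E′ = W′` be
elliptic curves over a number field `K`, `p` an odd prime, `θ : E′[p] ⥲ E[p]` a
`Γ_K`-isomorphism, and `v` a finite place (any residue characteristic, `v ∣ p` allowed) with
`|j(E)|_v > 1` and `|j(E′)|_v > 1` — i.e. each curve has multiplicative OR additive
potentially-multiplicative reduction at `v` — such that `γ(E) = r² γ(E′)` for some `r ∈ K_v`
(`γ = −c₄/c₆`, Silverman *ATAEC* V.5.2: the two curves become Tate curves over the SAME quadratic
extension `K_v(√γ)`, possibly ramified) and `μ_p(K_v) = 1`. Then `θ_* 𝓢_v(E′) ≤ 𝓢_v(E)`.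
FILE M1's data form `h1Equiv_mem_selmerLocalKer_of_twistedUniformisationAt` fed, for `E` and `E′`
at `v`, by p12's `AdditivePotMult.TateOfValuationJ.tateUniformisation_of_one_lt_valuation_j` (the
printed general form of A41, derived in the tree from A41 = `hU2`). [cite: SilvermanATAEC1994, Ch. V Lemma 5.2 (c), Thm. 5.3,
Cor. 5.4] [cite: CremonaMazur2000, §3] -/
theorem h1Equiv_mem_selmerLocalKer_of_one_lt_valuation_j
    (hU2 : Silverman1994_thmV53_corV54_tateUniformisation.{0}) (hp2 : p ≠ 2)
    (W' : WeierstrassCurve K) [W'.IsElliptic]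
    (θ : geomTorsion W' (p : ℤ) ≃+ geomTorsion W (p : ℤ))
    (hθ : ∀ (σ : absoluteGaloisGroup K) (P : geomTorsion W' (p : ℤ)), θ (σ • P) = σ • θ P)
    (hW : 1 < v.valuation K W.j) (hW' : 1 < v.valuation K W'.j)
    (hγ : ∃ r : (v.adicCompletion K), algebraMap K (v.adicCompletion K) (-(W.c₄ / W.c₆))
        = r ^ 2 * algebraMap K (v.adicCompletion K) (-(W'.c₄ / W'.c₆)))
    (hμ : ∀ ζ : (v.adicCompletion K), ζ ^ p = 1 → ζ = 1)
    {c : galH1Torsion W' (p : ℤ)} (hc : c ∈ selmerLocalKer W' (v.adicCompletion K) (p : ℤ)) :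
    h1Equiv θ hθ c ∈ selmerLocalKer W (v.adicCompletion K) (p : ℤ) :=
  h1Equiv_mem_selmerLocalKer_of_twistedUniformisationAt W v hp2 W' θ hθ
    (AdditivePotMult.TateOfValuationJ.tateUniformisation_of_one_lt_valuation_j hU2 W v hW)
    (AdditivePotMult.TateOfValuationJ.tateUniformisation_of_one_lt_valuation_j hU2 W' v hW') hγ hμ hc

/-- **`ι_v(θ) = 1` at a place where both curves have `|j|_v > 1` and the same twist class, and
`μ_p(K_v) = 1`** (the comparison index of `CongruenceVisibilityComparison.lean`), conditional on
A41 (`hU2`). [cite: SilvermanATAEC1994, Ch. V Lemma 5.2 (c), Thm. 5.3, Cor. 5.4]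
[cite: CremonaMazur2000, §3] -/
theorem relIndex_map_selmerLocalKer_eq_one_of_one_lt_valuation_j
    (hU2 : Silverman1994_thmV53_corV54_tateUniformisation.{0}) (hp2 : p ≠ 2)
    (W' : WeierstrassCurve K) [W'.IsElliptic]
    (θ : geomTorsion W' (p : ℤ) ≃+ geomTorsion W (p : ℤ))
    (hθ : ∀ (σ : absoluteGaloisGroup K) (P : geomTorsion W' (p : ℤ)), θ (σ • P) = σ • θ P)
    (hW : 1 < v.valuation K W.j) (hW' : 1 < v.valuation K W'.j)
    (hγ : ∃ r : (v.adicCompletion K), algebraMap K (v.adicCompletion K) (-(W.c₄ / W.c₆))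
        = r ^ 2 * algebraMap K (v.adicCompletion K) (-(W'.c₄ / W'.c₆)))
    (hμ : ∀ ζ : (v.adicCompletion K), ζ ^ p = 1 → ζ = 1) :
    (selmerLocalKer W (v.adicCompletion K) (p : ℤ)).relIndex
        ((selmerLocalKer W' (v.adicCompletion K) (p : ℤ)).map (h1Equiv θ hθ).toAddMonoidHom) = 1 :=
  (relIndex_map_selmerLocalKer_eq_one_iff W W' θ hθ).mpr fun _ hc ↦
    h1Equiv_mem_selmerLocalKer_of_one_lt_valuation_j W v hU2 hp2 W' θ hθ hW hW' hγ hμ hc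

/-! ### §3. The refined certificate with SIX free kinds -/

/-- **The refined visibility certificate with SIX free kinds**: `p` an odd prime,
`θ : E′[p] ⥲ E[p]` a `Γ_K`-isomorphism, `S ⊇ T` finite sets of finite places with both curves good
and `v ∤ p` outside `S`, `E(K)` finite of order prime to `p`, (a)
`∏_{v ∈ T} #E′(K_v)[p] · #(𝓞_v/p) < p^{rank E′(K)}`, and (b) every `v ∈ S \ T` of one of the free
kinds (i) `v ∤ p`, `E′(K_v)[p] = 0`; (ii) both split multiplicative, `#E(K_v)[p] ≤ p`; (iii) both
multiplicative, `γ(E) = r² γ(E′)` in `K_v`, `μ_p(K_v) = 1`; (iv′) `E` multiplicative with `γ(E)` a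
non-square in `K_v`, `E′` good, `v ∤ p`; (vi) `E` good, `E′` multiplicative with `γ(E′)` a
non-square in `K_v`, `v ∤ p`; **(iii′) `|j(E)|_v > 1`, `|j(E′)|_v > 1`, `γ(E) = r² γ(E′)` in `K_v`,
`μ_p(K_v) = 1`** (multiplicative or additive potentially-multiplicative on either side). Then
`Ш(E/K)` has a non-zero element killed by `p`. p04's `NonsplitKummer.exists_sha_ne_zero_of_congr_of_places₅`
re-assembled on `exists_sha_ne_zero_of_congr_of_le_off` with the sixth branch
`h1Equiv_mem_selmerLocalKer_of_one_lt_valuation_j`; conditional on A40 (`hU`) and A41 (`hU2`) —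
the same binders as `…_of_places₅`.
[cite: CremonaMazur2000, §3 and Table 1] [cite: AgasheStein2002, Thm. 3.1 and §3.5]
[cite: SilvermanATAEC1994, Ch. V Thm. 3.1, Lemma 5.2, Thm. 5.3, Cor. 5.4]
[cite: MilneADT2006, Ch. I Prop. 3.8] -/
theorem exists_sha_ne_zero_of_congr_of_places₆
    (hU : Silverman1994_thmV53_tateUniformisation.{0})
    (hU2 : Silverman1994_thmV53_corV54_tateUniformisation.{0})
    (hp2 : p ≠ 2) (W' : WeierstrassCurve K) [W'.IsElliptic]
    (θ : geomTorsion W' (p : ℤ) ≃+ geomTorsion W (p : ℤ))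
    (hθ : ∀ (σ : absoluteGaloisGroup K) (P : geomTorsion W' (p : ℤ)), θ (σ • P) = σ • θ P)
    (S T : Finset (HeightOneSpectrum (𝓞 K))) (hTS : T ⊆ S)
    (hS : ∀ w : HeightOneSpectrum (𝓞 K), w ∉ S →
      W.HasGoodReductionAt w ∧ W'.HasGoodReductionAt w ∧ (p : 𝓞 K) ∉ w.asIdeal)
    (hfin : Finite W.toAffine.Point) (hcop : (Nat.card W.toAffine.Point).Coprime p)
    (hT : (∏ w ∈ T, Nat.card (nsmulAddMonoidHom p :
        (W'.baseChange (w.adicCompletion K)).toAffine.Point →+ _).ker *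
        Nat.card (w.adicCompletionIntegers K ⧸
          Ideal.span {(p : w.adicCompletionIntegers K)})) < p ^ W'.mordellWeilRank)
    (hplaces : ∀ w ∈ S, w ∉ T →
      ((p : 𝓞 K) ∉ w.asIdeal ∧ Nat.card (nsmulAddMonoidHom p :
          (W'.baseChange (w.adicCompletion K)).toAffine.Point →+ _).ker = 1) ∨
      (W.HasSplitMultiplicativeReductionAt w ∧ W'.HasSplitMultiplicativeReductionAt w ∧
        Nat.card (nsmulAddMonoidHom p :
          (W.baseChange (w.adicCompletion K)).toAffine.Point →+ _).ker ≤ p) ∨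
      (W.HasMultiplicativeReductionAt w ∧ W'.HasMultiplicativeReductionAt w ∧
        (∃ r : w.adicCompletion K, algebraMap K (w.adicCompletion K) (-(W.c₄ / W.c₆)) =
          r ^ 2 * algebraMap K (w.adicCompletion K) (-(W'.c₄ / W'.c₆))) ∧
        (∀ ζ : w.adicCompletion K, ζ ^ p = 1 → ζ = 1)) ∨
      (W.HasMultiplicativeReductionAt w ∧
        ¬ IsSquare (algebraMap K (w.adicCompletion K) (-(W.c₄ / W.c₆))) ∧
        W'.HasGoodReductionAt w ∧ (p : 𝓞 K) ∉ w.asIdeal) ∨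
      (W.HasGoodReductionAt w ∧ W'.HasMultiplicativeReductionAt w ∧
        ¬ IsSquare (algebraMap K (w.adicCompletion K) (-(W'.c₄ / W'.c₆))) ∧
        (p : 𝓞 K) ∉ w.asIdeal) ∨
      (1 < w.valuation K W.j ∧ 1 < w.valuation K W'.j ∧
        (∃ r : w.adicCompletion K, algebraMap K (w.adicCompletion K) (-(W.c₄ / W.c₆)) =
          r ^ 2 * algebraMap K (w.adicCompletion K) (-(W'.c₄ / W'.c₆))) ∧
        (∀ ζ : w.adicCompletion K, ζ ^ p = 1 → ζ = 1))) :
    ∃ c : W.sha, c ≠ 0 ∧ p • c = 0 := by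
  have hpp : p.Prime := hp.out
  haveI := hfin
  refine exists_sha_ne_zero_of_congr_of_le_off W W' hp2 θ hθ S T hTS hS (fun w hw hwT c hc ↦ ?_) ?_
  · rcases hplaces w hw hwT with ⟨hwp, hloc⟩ | ⟨hWw, hW'w, hcardw⟩ | ⟨hWw, hW'w, hγw, hμw⟩ |
        ⟨hWw, hγw, hW'w, hwp⟩ | ⟨hWw, hW'w, hγw, hwp⟩ | ⟨hWw, hW'w, hγw, hμw⟩
    · exact (relIndex_map_selmerLocalKer_eq_one_iff W W' θ hθ).mp
        (relIndex_map_selmerLocalKer_eq_one_of_card_torsion_eq_one W W' θ hθ hwp hloc) c hc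
    · exact W.h1Equiv_mem_selmerLocalKer_of_hasSplitMultiplicativeReductionAt w hU W' θ hθ hWw
        hW'w hcardw hc
    · exact W.h1Equiv_mem_selmerLocalKer_of_hasMultiplicativeReductionAt w hU2 hp2 W' θ hθ hWw
        hW'w hγw hμw hc
    · exact NonsplitKummer.h1Equiv_mem_selmerLocalKer_of_nonsplit_of_hasGoodReductionAt W w hU2 hp2
        W' θ hθ hWw hγw hW'w hwp hc
    · exact NonsplitKummer.h1Equiv_mem_selmerLocalKer_of_hasGoodReductionAt_of_nonsplit W W' w hU2
        hp2 θ hθ hWw hW'w hγw hwp hc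
    · exact h1Equiv_mem_selmerLocalKer_of_one_lt_valuation_j W w hU2 hp2 W' θ hθ hWw hW'w hγw hμw
        hc
  · rw [index_range_zsmul_eq_one_of_coprime hcop, one_mul,
      Finset.prod_congr rfl fun w _ ↦
        (W'.natCard_kummerLocalConditionAt_adicCompletion w hpp.ne_zero)]
    exact lt_of_lt_of_le hT (pow_mordellWeilRank_le_index_range_zsmul W' hpp.ne_zero)

end KindIIIPrime

/-! ### §4. ℚ reading: `|x|_v > 1 ↔ ord_ℓ x < 0 ↔ ℓ ∣ den x` -/

section RatReading

open Rat.HeightOneSpectrum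

variable (v : HeightOneSpectrum (𝓞 ℚ))

/-- **`1 < v(x) ↔ ord_ℓ(x) < 0`** for a non-zero rational `x` at the place `v` of `ℚ` over the
prime `ℓ` (Mathlib `Rat.HeightOneSpectrum.valuation_equiv_padicValuation`; `v(x) = exp(−ord_ℓ x)`).
Records: with `x = j(E)`, kind (iii′)'s hypothesis `1 < v.valuation ℚ W.j` is `ord_ℓ j(E) < 0`.
[folklore] -/
theorem one_lt_valuation_iff_padicValRat_neg {ℓ : ℕ} [Fact ℓ.Prime]
    (hv : (primesEquiv v : ℕ) = ℓ) {x : ℚ} (hx : x ≠ 0) :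
    1 < v.valuation ℚ x ↔ padicValRat ℓ x < 0 := by
  rw [(valuation_equiv_padicValuation v).one_lt_iff_one_lt]
  subst hv
  change 1 < (if x = 0 then (0 : WithZero (Multiplicative ℤ)) else WithZero.exp (-padicValRat _ x)) ↔ _
  rw [if_neg hx, ← WithZero.exp_zero, WithZero.exp_lt_exp]
  omega

/-- **`1 < v(x) ↔ ℓ ∣ den x`** for a non-zero rational `x` (`decide`-able on literals; tree
`LocalDivisibility.padicValRat_lt_zero_iff_dvd_den`). [folklore] -/
theorem one_lt_valuation_iff_dvd_den {ℓ : ℕ} [Fact ℓ.Prime]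
    (hv : (primesEquiv v : ℕ) = ℓ) {x : ℚ} (hx : x ≠ 0) :
    1 < v.valuation ℚ x ↔ ℓ ∣ x.den := by
  rw [one_lt_valuation_iff_padicValRat_neg v hv hx,
    LocalDivisibility.padicValRat_lt_zero_iff_dvd_den]

/-- **Records wrapper**: `1 < v(x)` from a displayed evaluation `x = q` (e.g. `W.j = q` by
`j_eq_c₄_pow_div` + `norm_num` on an integer model) and the `decide`-able test `ℓ ∣ den q`.
[folklore] -/
theorem one_lt_valuation_of_eq_of_dvd_den {ℓ : ℕ} [Fact ℓ.Prime]
    (hv : (primesEquiv v : ℕ) = ℓ) {x q : ℚ} (hx : x = q) (hq0 : q ≠ 0) (hq : ℓ ∣ q.den) :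
    1 < v.valuation ℚ x :=
  hx ▸ (one_lt_valuation_iff_dvd_den v hv hq0).mpr hq

/-- **KIND (iii′) NUMERALS over `ℚ`, decided** — the sixth disjunct of
`exists_sha_ne_zero_of_congr_of_places₆` at the place `v` of `p` for curves `W`, `W′` over `ℚ`,
from per-row data a records seat displays or `decide`s: the two `j`-invariants `j(W) = q`,
`j(W′) = q′` (rational literals, `p ∣ den`), the twist-class certificate of p17's
`LocalTorsion3At.exists_eq_sq_mul_of_sqFlagAt` (`A/B = N/D` with `A = −c₄/c₆`, `B = −c₄′/c₆′`,
`p^w ∥ N·D`, `sqFlagAt p (N·D) w = true`) and the `μ₃(ℚ_v) = 1` certificate of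
`LocalTorsion3At.forall_pow_three_eq_one_adicCompletion_of_sqFlagAt` (`sqFlagAt p (−3) w₃ = false`,
`p^{w₃} ∥ −3`; at `p = 3`: `w₃ = 1`). Specific to the prime `3` only through the last conjunct
(`μ_3`), as kind (iii′) is used by the cell. [cite: SilvermanATAEC1994, Ch. V Lemma 5.2 (c),
Thm. 5.3, Cor. 5.4] -/
theorem kindIIIPrime_numerals_three_of_certs {p : ℕ} [Fact p.Prime] (hv : (primesEquiv v : ℕ) = p)
    (W W' : WeierstrassCurve ℚ) [W.IsElliptic] [W'.IsElliptic] {q q' : ℚ} (hj : W.j = q)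
    (hq0 : q ≠ 0) (hq : p ∣ q.den)
    (hj' : W'.j = q') (hq0' : q' ≠ 0) (hq' : p ∣ q'.den)
    {A B : ℚ} (hA : -(W.c₄ / W.c₆) = A) (hBdef : -(W'.c₄ / W'.c₆) = B) (hB : B ≠ 0)
    {N D : ℤ} (hD : D ≠ 0) (hAB : A / B = (N : ℚ) / (D : ℚ))
    {w : ℕ} (hw : (p : ℤ) ^ w ∣ N * D) (hw' : ¬ (p : ℤ) ^ (w + 1) ∣ N * D)
    (hflag : LocalTorsion3At.sqFlagAt p (N * D) w = true)
    {w₃ : ℕ} (hw₃ : (p : ℤ) ^ w₃ ∣ (-3 : ℤ)) (hw₃' : ¬ (p : ℤ) ^ (w₃ + 1) ∣ (-3 : ℤ))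
    (hflag₃ : LocalTorsion3At.sqFlagAt p (-3) w₃ = false) :
    1 < v.valuation ℚ W.j ∧ 1 < v.valuation ℚ W'.j ∧
      (∃ r : v.adicCompletion ℚ, algebraMap ℚ (v.adicCompletion ℚ) (-(W.c₄ / W.c₆)) =
        r ^ 2 * algebraMap ℚ (v.adicCompletion ℚ) (-(W'.c₄ / W'.c₆))) ∧
      (∀ ζ : v.adicCompletion ℚ, ζ ^ 3 = 1 → ζ = 1) := by
  refine ⟨one_lt_valuation_of_eq_of_dvd_den v hv hj hq0 hq,
    one_lt_valuation_of_eq_of_dvd_den v hv hj' hq0' hq', ?_,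
    LocalTorsion3At.forall_pow_three_eq_one_adicCompletion_of_sqFlagAt v hv hw₃ hw₃' hflag₃⟩
  rw [hA, hBdef]
  exact LocalTorsion3At.exists_eq_sq_mul_of_sqFlagAt v hv hB hD hAB hw hw' hflag

end RatReading

end TwistedKummer

end Summit.BirchSwinnertonDyer.Rank1Residual.GaloisImage

end
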